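import Summits.NavierStokesRegularity.NavierStokesRegularity.Theorems.SqueezeCycleSingularZoomExtraction
import Summits.NavierStokesRegularity.NavierStokesRegularity.Theorems.TypeILiouvilleTypeIliouvilleNoTypeIIStubActiveWindowsRegularity
import Summits.NavierStokesRegularity.NavierStokesRegularity.Theorems.TypeILiouvilleTypeIliouvilleNoTypeIIStubActiveWindowsBoxes
import HarnessLib

/-!
# `C¹_loc` compactness of bounded Oseen-mild fields on growing two-sided windows
# (crux `TypeIliouvilleNoTypeII`, stmt-NavierStokesRegularity-0056, line `Sketch`, stub
# `stub_activeWindowsGenerateNonconstant`)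

Helper file (theorems only) for the two-sided ("immortal") zoom of the line: the bounded,
two-sided twin of the tree's `exists_tendsto_of_typeI_seq_Ioo` (`SqueezeCycleSingularZoomExtraction`).
A sequence `w k` of fields which are jointly continuous on `(A k, B k) × ℝ³`, have weakly
divergence-free slices there, satisfy the Oseen integral equation between all
`A k < s < t < B k` and obey a common bound `‖w k t x‖ ≤ N` on `(A k, B k)`, where `A k → -∞` and
`B k → +∞`, has a subsequence converging together with its spatial gradients at every point of
`ℝ × ℝ³` to a bounded ETERNAL Oseen-mild field `W`: jointly `C^∞` on `ℝ × ℝ³`, divergence free,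
`W t x = e^{(t-s)Δ}W(s)(x) - B¹_s(W,W)(t)(x)` for all `s < t`, `‖W‖ ≤ N`
(`exists_tendsto_of_bounded_seq`). On each compact box `[-(n+1), n+1] × B̄(0, n+1)`
(`TypeILiouvilleTypeIliouvilleNoTypeIIStubActiveWindowsBoxes`) the pairs
`(w k, ∇w k)` are bounded and uniformly Lipschitz for all large `k` (the window-uniform bounds of
`TypeILiouvilleTypeIliouvilleNoTypeIIStubActiveWindowsRegularity`, KNSS 2009 Prop. 4.1,
(4.10)–(4.11)), a diagonal Arzelà–Ascoli extraction gives the limit pair, uniform limits of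
gradients are gradients, and the bound, weak divergence-freeness and the Oseen equation pass to the
limit by dominated convergence (KNSS 2009, Lemma 6.1).
-/

noncomputable section

-- the summit and its single problem share the name (D-0017 nested layout)
set_option linter.dupNamespace false

open MeasureTheory Set Function Filter TopologicalSpace Metric
open scoped Topology NNReal ENNReal InnerProductSpace RealInnerProductSpace

namespace Summit.NavierStokesRegularity.NavierStokesRegularity.Theorems.TypeIliouvilleNoTypeII.ImmortalZoom

open Literature.Analysis Literature.Analysis.FluidPDE
open Summit.NavierStokesRegularity.NavierStokesRegularity.Theorems

/-! ### The extraction -/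

section Compactness

/-- **`C¹_loc` compactness of bounded Oseen-mild fields on growing two-sided windows.** Let `w k`
be jointly continuous on `(A k, B k) × ℝ³` with weakly divergence-free slices, satisfy the Oseen
integral equation `w k t = e^{(t−s)Δ} w k s − B¹_s(w k, w k)(t)` for all `A k < s < t < B k`, and
obey `‖w k t x‖ ≤ N` for `A k < t < B k`, where `A k → −∞` and `B k → +∞`. Then along some
subsequence `φ` the fields and their spatial gradients converge at every point of `ℝ × ℝ³` to a
bounded ETERNAL Oseen-mild field `W` — jointly smooth, divergence free, `‖W‖ ≤ N`,
`W(t) = e^{(t−s)Δ}W(s) − B¹_s(W, W)(t)` for all `s < t` — and to its gradient. [cite: KochNadirashviliSereginSverak2009, Lemma 6.1 and Prop. 4.1 (arXiv:0709.3599 pp. 8, 11)] -/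
theorem exists_tendsto_of_bounded_seq (N : ℝ) {A B : ℕ → ℝ} (hA : Tendsto A atTop atBot)
    (hB : Tendsto B atTop atTop)
    {w : ℕ → ℝ → EuclideanSpace ℝ (Fin 3) → EuclideanSpace ℝ (Fin 3)}
    (hc : ∀ k, ContinuousOn (uncurry (w k)) (Ioo (A k) (B k) ×ˢ univ))
    (hdivw : ∀ k, ∀ t ∈ Ioo (A k) (B k), IsWeaklyDivFree (w k t))
    (hmild : ∀ k, ∀ s t : ℝ, A k < s → s < t → t < B k → ∀ x,
      w k t x = UnboundedOperators.heatExtension (w k s) (t - s) x - oseenDuhamel 1 s (w k) (w k) t x)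
    (hbd : ∀ k, ∀ t ∈ Ioo (A k) (B k), ∀ x, ‖w k t x‖ ≤ N) :
    ∃ φ : ℕ → ℕ, StrictMono φ ∧
      ∃ W : ℝ → EuclideanSpace ℝ (Fin 3) → EuclideanSpace ℝ (Fin 3),
        ContDiff ℝ (⊤ : ℕ∞) (uncurry W) ∧ (∀ t, VectorCalculus.IsDivFree (W t)) ∧
        (∀ s t : ℝ, s < t → ∀ x, W t x = heatFlow (W s) (t - s) x - oseenDuhamel 1 s W W t x) ∧
        (∀ t x, ‖W t x‖ ≤ N) ∧
        (∀ t x, Tendsto (fun j => w (φ j) t x) atTop (𝓝 (W t x))) ∧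
        (∀ t x, Tendsto (fun j => fderiv ℝ (w (φ j) t) x) atTop (𝓝 (fderiv ℝ (W t) x))) := by
  -- ## Step 0: per-`k` facts on `(A k, B k)`
  have hsm : ∀ k, ContDiffOn ℝ (⊤ : ℕ∞) (uncurry (w k)) (Ioo (A k) (B k) ×ˢ univ) := fun k =>
    contDiffOn_of_bounded (hc k) (hdivw k) (hmild k) (hbd k)
  have hDc : ∀ k, ContinuousOn (fun z : ℝ × EuclideanSpace ℝ (Fin 3) => fderiv ℝ (w k z.1) z.2)
      (Ioo (A k) (B k) ×ˢ univ) := fun k =>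
    IsSmoothSpaceTimeOn.continuousOn_fderiv_slice (S := Ioo (A k) (B k)) (w := w k) (hsm k)
      isOpen_Ioo.uniqueDiffOn
  have hsmooth : ∀ k, ∀ t ∈ Ioo (A k) (B k), ContDiff ℝ ((⊤ : ℕ∞) : WithTop ℕ∞) (w k t) :=
    fun k t ht => (hsm k).comp_contDiff (contDiff_prodMk_right t) fun x => ⟨ht, mem_univ x⟩
  have hdiff : ∀ k, ∀ t ∈ Ioo (A k) (B k), Differentiable ℝ (w k t) := fun k t ht =>
    (hsmooth k t ht).differentiable (by simp)
  have hdiff2 : ∀ k, ∀ t ∈ Ioo (A k) (B k), Differentiable ℝ (fderiv ℝ (w k t)) := fun k t ht =>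
    ((hsmooth k t ht).fderiv_right (m := 1) (by norm_cast)).differentiable (by simp)
  have hslice : ∀ k, ∀ t ∈ Ioo (A k) (B k), Continuous (w k t) := fun k t ht =>
    (hc k).comp_continuous (Continuous.prodMk_right t) fun x => ⟨ht, mem_univ x⟩
  -- ## Step 1: windows and window-uniform constants on the boxes
  set a : ℕ → ℝ := fun n => -((n : ℝ) + 2) with ha
  set b : ℕ → ℝ := fun n => (n : ℝ) + 2 with hb
  have hab : ∀ n, a n < b n := fun n => by
    simp only [ha, hb]; linarith [(Nat.cast_nonneg n : (0 : ℝ) ≤ n)]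
  -- eventually the window `[a n, b n]` lies inside `(A k, B k)`
  have hAa : ∀ n, ∀ᶠ k in atTop, A k < a n ∧ b n < B k := fun n =>
    (hA.eventually (eventually_lt_atBot (a n))).and (hB.eventually (eventually_gt_atTop (b n)))
  -- the boxes
  set T : ℕ → Set (ℝ × EuclideanSpace ℝ (Fin 3)) := fun n =>
    Icc (-((n : ℝ) + 1)) ((n : ℝ) + 1) ×ˢ closedBall (0 : EuclideanSpace ℝ (Fin 3)) ((n : ℝ) + 1)
    with hT
  have hTwin : ∀ n, ∀ z ∈ T n, z.1 ∈ Ico (a n + 1) (b n) := fun n z hz => by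
    obtain ⟨⟨h1, h2⟩, -⟩ := mem_boxPiece.1 hz
    refine ⟨by simp only [ha]; linarith, lt_of_le_of_lt h2 ?_⟩
    simp only [hb]; linarith
  have hTA : ∀ n k, A k < a n ∧ b n < B k → ∀ z ∈ T n, z.1 ∈ Ioo (A k) (B k) := fun n k hk z hz =>
    ⟨by linarith [(hTwin n z hz).1, hk.1], (hTwin n z hz).2.trans hk.2⟩
  -- constants
  have e1 := fun n : ℕ => exists_norm_iteratedFDeriv_le_of_bounded N 1 (hab n) one_pos
  have e2 := fun n : ℕ => exists_norm_iteratedFDeriv_le_of_bounded N 2 (hab n) one_pos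
  have l0 := fun n : ℕ => exists_lipschitz_time_of_bounded N 0 (hab n) one_pos
  have l1 := fun n : ℕ => exists_lipschitz_time_of_bounded N 1 (hab n) one_pos
  choose K1 hK1 using e1
  choose K2 hK2 using e2
  choose L0 hL00 hL0 using l0
  choose L1 hL10 hL1 using l1
  -- pointwise bounds on the boxes, for every `k` whose window contains `[a n, b n]`
  have hB0 : ∀ n k, A k < a n ∧ b n < B k → ∀ z ∈ T n, ‖w k z.1 z.2‖ ≤ N := fun n k hk z hz =>
    hbd k z.1 (hTA n k hk z hz) z.2
  have hB1 : ∀ n k, A k < a n ∧ b n < B k → ∀ t ∈ Ico (a n + 1) (b n), ∀ x,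
      ‖fderiv ℝ (w k t) x‖ ≤ K1 n := fun n k hk t ht x => by
    have h := hK1 n hk.1 hk.2 (hc k) (hdivw k) (hmild k) (hbd k) t ht x
    rwa [norm_iteratedFDeriv_one] at h
  have hB2 : ∀ n k, A k < a n ∧ b n < B k → ∀ t ∈ Ico (a n + 1) (b n), ∀ x,
      ‖fderiv ℝ (fderiv ℝ (w k t)) x‖ ≤ K2 n := fun n k hk t ht x => by
    have h := hK2 n hk.1 hk.2 (hc k) (hdivw k) (hmild k) (hbd k) t ht x
    rwa [← FunctionSpaces.norm_fderiv_fderiv_eq_norm_iteratedFDeriv_two] at h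
  have hab1 : ∀ n, a n + 1 < b n := fun n => by
    simp only [ha, hb]; linarith [(Nat.cast_nonneg n : (0 : ℝ) ≤ n)]
  have hK1nn : ∀ n, 0 ≤ K1 n := fun n => by
    obtain ⟨k, hk⟩ := (hAa n).exists
    exact (norm_nonneg _).trans (hB1 n k hk (a n + 1) ⟨le_rfl, hab1 n⟩ 0)
  have hK2nn : ∀ n, 0 ≤ K2 n := fun n => by
    obtain ⟨k, hk⟩ := (hAa n).exists
    exact (norm_nonneg (fderiv ℝ (fderiv ℝ (w k (a n + 1))) 0)).trans
      (hB2 n k hk (a n + 1) ⟨le_rfl, hab1 n⟩ 0)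
  -- ## Step 2: the pair maps and their moduli on the boxes (for all large `k`)
  set V : ℕ → ℝ × EuclideanSpace ℝ (Fin 3) →
      EuclideanSpace ℝ (Fin 3) × (EuclideanSpace ℝ (Fin 3) →L[ℝ] EuclideanSpace ℝ (Fin 3)) :=
    fun k z => (w k z.1 z.2, fderiv ℝ (w k z.1) z.2) with hV
  have hVn : ∀ n : ℕ, ∀ᶠ k in atTop, ContinuousOn (V k) (T n) ∧
      (∀ z ∈ T n, ‖V k z‖ ≤ max N (K1 n)) ∧
      ∀ z ∈ T n, ∀ z' ∈ T n,
        dist (V k z) (V k z') ≤ (K1 n + L0 n + (K2 n + L1 n)) * dist z z' ^ (1 : ℝ) := by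
    intro n
    filter_upwards [hAa n] with k hk
    refine ⟨?_, fun z hz => ?_, fun z hz z' hz' => ?_⟩
    · have hsub : T n ⊆ Ioo (A k) (B k) ×ˢ univ := fun z hz => ⟨hTA n k hk z hz, mem_univ _⟩
      exact ((hc k).mono hsub).prodMk ((hDc k).mono hsub)
    · rw [hV, Prod.norm_mk]
      exact max_le_max (hB0 n k hk z hz) (hB1 n k hk z.1 (hTwin n z hz) z.2)
    · rw [Real.rpow_one]
      have ht := hTwin n z hz
      have ht' := hTwin n z' hz'
      have hzA := hTA n k hk z hz
      have hdt : |z.1 - z'.1| ≤ dist z z' := by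
        rw [← Real.dist_eq, Prod.dist_eq]; exact le_max_left _ _
      have hdx : ‖z.2 - z'.2‖ ≤ dist z z' := by
        rw [← dist_eq_norm, Prod.dist_eq]; exact le_max_right _ _
      have hd0 : 0 ≤ dist z z' := dist_nonneg
      -- values
      have hv1 : ‖w k z.1 z.2 - w k z.1 z'.2‖ ≤ K1 n * ‖z.2 - z'.2‖ :=
        (convex_univ.norm_image_sub_le_of_norm_fderiv_le (fun x _ => (hdiff k z.1 hzA) x)
          (fun x _ => hB1 n k hk z.1 ht x) (mem_univ z'.2) (mem_univ z.2))
      have hv2 : ‖w k z.1 z'.2 - w k z'.1 z'.2‖ ≤ L0 n * |z.1 - z'.1| := by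
        have h := hL0 n hk.1 hk.2 (hc k) (hdivw k) (hmild k) (hbd k) z'.1 ht' z.1 ht z'.2
        rwa [DerivInterp.norm_iteratedFDeriv_zero_sub] at h
      have hval : ‖w k z.1 z.2 - w k z'.1 z'.2‖ ≤ (K1 n + L0 n) * dist z z' := by
        calc ‖w k z.1 z.2 - w k z'.1 z'.2‖
            ≤ ‖w k z.1 z.2 - w k z.1 z'.2‖ + ‖w k z.1 z'.2 - w k z'.1 z'.2‖ :=
              norm_sub_le_norm_sub_add_norm_sub _ _ _
          _ ≤ K1 n * dist z z' + L0 n * dist z z' := add_le_add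
              (hv1.trans (mul_le_mul_of_nonneg_left hdx (hK1nn n)))
              (hv2.trans (mul_le_mul_of_nonneg_left hdt (hL00 n)))
          _ = (K1 n + L0 n) * dist z z' := by ring
      -- gradients
      have hg1 : ‖fderiv ℝ (w k z.1) z.2 - fderiv ℝ (w k z.1) z'.2‖ ≤ K2 n * ‖z.2 - z'.2‖ :=
        (convex_univ.norm_image_sub_le_of_norm_fderiv_le
          (fun x _ => (hdiff2 k z.1 hzA) x)
          (fun x _ => hB2 n k hk z.1 ht x) (mem_univ z'.2) (mem_univ z.2))
      have hg2 : ‖fderiv ℝ (w k z.1) z'.2 - fderiv ℝ (w k z'.1) z'.2‖ ≤ L1 n * |z.1 - z'.1| := by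
        have h := hL1 n hk.1 hk.2 (hc k) (hdivw k) (hmild k) (hbd k) z'.1 ht' z.1 ht z'.2
        rwa [norm_iteratedFDeriv_one_sub] at h
      have hgrad : ‖fderiv ℝ (w k z.1) z.2 - fderiv ℝ (w k z'.1) z'.2‖ ≤
          (K2 n + L1 n) * dist z z' := by
        calc ‖fderiv ℝ (w k z.1) z.2 - fderiv ℝ (w k z'.1) z'.2‖
            ≤ ‖fderiv ℝ (w k z.1) z.2 - fderiv ℝ (w k z.1) z'.2‖ +
                ‖fderiv ℝ (w k z.1) z'.2 - fderiv ℝ (w k z'.1) z'.2‖ :=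
              norm_sub_le_norm_sub_add_norm_sub _ _ _
          _ ≤ K2 n * dist z z' + L1 n * dist z z' := add_le_add
              (hg1.trans (mul_le_mul_of_nonneg_left hdx (hK2nn n)))
              (hg2.trans (mul_le_mul_of_nonneg_left hdt (hL10 n)))
          _ = (K2 n + L1 n) * dist z z' := by ring
      rw [hV, dist_eq_norm, Prod.mk_sub_mk, Prod.norm_mk]
      refine max_le (hval.trans ?_) (hgrad.trans ?_)
      · exact mul_le_mul_of_nonneg_right (by linarith [hK2nn n, hL10 n]) hd0
      · exact mul_le_mul_of_nonneg_right (by linarith [hK1nn n, hL00 n]) hd0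
  -- ## Step 3: extraction
  obtain ⟨φ, hφ, P, hP⟩ := exists_strictMono_tendstoUniformlyOn_of_bound
    (fun n => isCompact_boxPiece (E := EuclideanSpace ℝ (Fin 3)) n)
    (fun n => by linarith [hK1nn n, hL00 n, hK2nn n, hL10 n]) (fun _ => one_pos) hVn
  set W : ℝ → EuclideanSpace ℝ (Fin 3) → EuclideanSpace ℝ (Fin 3) := fun t x => (P (t, x)).1 with hWdef
  set G : ℝ → EuclideanSpace ℝ (Fin 3) → (EuclideanSpace ℝ (Fin 3) →L[ℝ] EuclideanSpace ℝ (Fin 3)) :=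
    fun t x => (P (t, x)).2 with hGdef
  have hW0 : ∀ n, TendstoUniformlyOn (fun j z => w (φ j) z.1 z.2) (fun z => W z.1 z.2) atTop (T n) :=
    fun n => by
    have h := uniformContinuous_fst.comp_tendstoUniformlyOn (hP n)
    exact (h.congr (Eventually.of_forall fun j => fun z _ => rfl)).congr_right fun z _ => rfl
  have hG0 : ∀ n, TendstoUniformlyOn (fun j z => fderiv ℝ (w (φ j) z.1) z.2) (fun z => G z.1 z.2) atTop
      (T n) := fun n => by
    have h := uniformContinuous_snd.comp_tendstoUniformlyOn (hP n)
    exact (h.congr (Eventually.of_forall fun j => fun z _ => rfl)).congr_right fun z _ => rfl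
  have hφt : Tendsto φ atTop atTop := hφ.tendsto_atTop
  have hAφ : Tendsto (fun j => A (φ j)) atTop atBot := hA.comp hφt
  have hBφ : Tendsto (fun j => B (φ j)) atTop atTop := hB.comp hφt
  -- eventually (in `j`) the levels `s ≤ t` are inside the window of `w (φ j)`
  have hlev : ∀ s t : ℝ, ∃ j₀ : ℕ, ∀ j, j₀ ≤ j → A (φ j) < s ∧ t < B (φ j) := fun s t =>
    eventually_atTop.1 ((hAφ.eventually (eventually_lt_atBot s)).and
      (hBφ.eventually (eventually_gt_atTop t)))
  -- continuity of the limit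
  have hWc : Continuous (uncurry W) := by
    have hVφ : ∀ n, ∀ᶠ j in atTop, ContinuousOn (fun z : ℝ × EuclideanSpace ℝ (Fin 3) => w (φ j) z.1 z.2)
        (T n) := fun n => by
      filter_upwards [hφt.eventually (hAa n)] with j hj
      exact (hc (φ j)).mono fun z hz => ⟨hTA n (φ j) hj z hz, mem_univ _⟩
    exact (continuous_of_tendstoUniformlyOn_boxPiece hVφ hW0).congr fun z => rfl
  -- pointwise convergence of values and gradients
  have hpt : ∀ t x, Tendsto (fun j => w (φ j) t x) atTop (𝓝 (W t x)) := fun t x =>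
    tendsto_of_tendstoUniformlyOn_boxPiece hW0 t x
  have hptG : ∀ t x, Tendsto (fun j => fderiv ℝ (w (φ j) t) x) atTop (𝓝 (G t x)) :=
    fun t x => tendsto_of_tendstoUniformlyOn_boxPiece hG0 t x
  -- the limit of the gradients is the gradient of the limit (shift past the window entrance)
  have hWD : ∀ t x, HasFDerivAt (W t) (G t x) x := by
    intro t x
    obtain ⟨j₀, hj₀⟩ := hlev t t
    have hG0' : ∀ n, TendstoUniformlyOn (fun j z => fderiv ℝ (w (φ (j + j₀)) z.1) z.2)
        (fun z => G z.1 z.2) atTop (T n) := fun n => tendstoUniformlyOn_shift (hG0 n) j₀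
    have hluG' : TendstoLocallyUniformly (fun j => fderiv ℝ (w (φ (j + j₀)) t)) (G t) atTop :=
      tendstoLocallyUniformly_slice_of_tendstoUniformlyOn_boxPiece hG0' t
    refine hasFDerivAt_of_tendstoLocallyUniformlyOn isOpen_univ hluG'.tendstoLocallyUniformlyOn
      (fun j y _ => ((hdiff (φ (j + j₀)) t (hj₀ _ (Nat.le_add_left _ _))) y).hasFDerivAt)
      (fun y _ => (hpt t y).comp (tendsto_add_atTop_nat j₀)) (mem_univ x)
  have hWG : ∀ t x, fderiv ℝ (W t) x = G t x := fun t x => (hWD t x).fderiv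
  -- ## Step 4a: weak divergence-freeness of the limit slices
  have hN0 : 0 ≤ N := by
    obtain ⟨k, hk⟩ := (hAa 0).exists
    exact (norm_nonneg _).trans (hbd k 0 ⟨by simp only [ha] at hk; linarith [hk.1],
      by simp only [hb] at hk; linarith [hk.2]⟩ 0)
  have hWdiv : ∀ t, IsWeaklyDivFree (W t) := by
    intro t θ hθ
    obtain ⟨j₀, hj₀⟩ := hlev t t
    have hev : ∀ᶠ j in atTop, A (φ j) < t ∧ t < B (φ j) := eventually_atTop.2 ⟨j₀, hj₀⟩
    have hθ1 : ContDiff ℝ 1 θ := contDiff_infty.1 hθ.contDiff 1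
    have hgc : HasCompactSupport (gradient θ) := by
      have : gradient θ = (fun L => (InnerProductSpace.toDual ℝ (EuclideanSpace ℝ (Fin 3))).symm L) ∘
          fderiv ℝ θ := rfl
      rw [this]
      exact (hθ.hasCompactSupport.fderiv (𝕜 := ℝ)).comp_left (by simp)
    have hθi : Integrable (fun x => N * ‖gradient θ x‖) volume :=
      (((continuous_gradient_of_contDiff hθ1).integrable_of_hasCompactSupport hgc).norm).const_mul N
    have hlimθ : Tendsto (fun j => ∫ x, ⟪w (φ j) t x, gradient θ x⟫_ℝ) atTop
        (𝓝 (∫ x, ⟪W t x, gradient θ x⟫_ℝ)) := by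
      refine tendsto_integral_filter_of_dominated_convergence (fun x => N * ‖gradient θ x‖)
        ?_ ?_ hθi (Eventually.of_forall fun x => (hpt t x).inner tendsto_const_nhds)
      · filter_upwards [hev] with j hj
        exact ((hslice (φ j) t hj).inner (continuous_gradient_of_contDiff hθ1)).aestronglyMeasurable
      · filter_upwards [hev] with j hj
        exact Eventually.of_forall fun x =>
          (norm_inner_le_norm _ _).trans
            (mul_le_mul_of_nonneg_right (hbd (φ j) t hj x) (norm_nonneg _))
    have hzero : ∀ᶠ j in atTop, (0 : ℝ) = ∫ x, ⟪w (φ j) t x, gradient θ x⟫_ℝ := by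
      filter_upwards [hev] with j hj
      exact (hdivw (φ j) t hj θ hθ).symm
    exact tendsto_nhds_unique hlimθ (tendsto_const_nhds.congr' hzero)
  -- ## Step 4b: the bound of the limit
  have hWN : ∀ t x, ‖W t x‖ ≤ N := by
    intro t x
    obtain ⟨j₀, hj₀⟩ := hlev t t
    exact le_of_tendsto (hpt t x).norm
      (eventually_atTop.2 ⟨j₀, fun j hj => hbd (φ j) t (hj₀ j hj) x⟩)
  -- ## Step 5: the Oseen identity in the limit (shift past the window entrance at levels `s, t`)
  have hWmild : ∀ s t : ℝ, s < t → ∀ x,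
      W t x = UnboundedOperators.heatExtension (W s) (t - s) x - oseenDuhamel 1 s W W t x := by
    intro s t hst x
    obtain ⟨j₀, hj₀⟩ := hlev s t
    set u : ℕ → ℝ → EuclideanSpace ℝ (Fin 3) → EuclideanSpace ℝ (Fin 3) := fun j => w (φ (j + j₀)) with hu
    have hAu : ∀ j, A (φ (j + j₀)) < s ∧ t < B (φ (j + j₀)) := fun j => hj₀ _ (Nat.le_add_left _ _)
    have hptu : ∀ τ y, Tendsto (fun j => u j τ y) atTop (𝓝 (W τ y)) := fun τ y =>
      (hpt τ y).comp (tendsto_add_atTop_nat j₀)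
    have huM : ∀ j, ∀ τ ∈ Ioo s t, ∀ y, ‖u j τ y‖ ≤ N := fun j τ hτ y =>
      hbd _ τ ⟨(hAu j).1.trans hτ.1, hτ.2.trans (hAu j).2⟩ y
    have hum : ∀ j, AEStronglyMeasurable (uncurry (u j))
        ((volume : Measure (ℝ × EuclideanSpace ℝ (Fin 3))).restrict (Ioo s t ×ˢ univ)) := fun j =>
      ((hc _).mono (prod_mono (fun τ hτ => ⟨(hAu j).1.trans hτ.1, hτ.2.trans (hAu j).2⟩)
        Subset.rfl)).aestronglyMeasurable (measurableSet_Ioo.prod MeasurableSet.univ)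
    have hWm : AEStronglyMeasurable (uncurry W)
        ((volume : Measure (ℝ × EuclideanSpace ℝ (Fin 3))).restrict (Ioo s t ×ˢ univ)) :=
      hWc.aestronglyMeasurable
    have hD : Tendsto (fun j => oseenDuhamel 1 s (u j) (u j) t x) atTop (𝓝 (oseenDuhamel 1 s W W t x)) :=
      tendsto_oseenDuhamel_of_tendsto_of_bound one_pos hN0 hst hum hWm huM
        (fun τ _ y => hptu τ y) x
    have hH : Tendsto (fun j => UnboundedOperators.heatExtension (u j s) (t - s) x) atTop
        (𝓝 (UnboundedOperators.heatExtension (W s) (t - s) x)) :=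
      tendsto_heatExtension_of_tendsto_of_bound (M := N)
        (fun j => (hslice _ s ⟨(hAu j).1, hst.trans (hAu j).2⟩).aestronglyMeasurable)
        (fun j z => hbd _ s ⟨(hAu j).1, hst.trans (hAu j).2⟩ z)
        (hptu s) (sub_pos.2 hst) x
    have hid : (fun j => u j t x) = fun j =>
        UnboundedOperators.heatExtension (u j s) (t - s) x - oseenDuhamel 1 s (u j) (u j) t x :=
      funext fun j => hmild _ s t (hAu j).1 hst (hAu j).2 x
    have hlim2 : Tendsto (fun j => u j t x) atTop
        (𝓝 (UnboundedOperators.heatExtension (W s) (t - s) x - oseenDuhamel 1 s W W t x)) := by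
      rw [hid]; exact hH.sub hD
    exact tendsto_nhds_unique (hptu t x) hlim2
  -- ## Conclusion
  refine ⟨φ, hφ, W, contDiff_of_eternal hWc hWdiv hWmild hWN,
    isDivFree_of_eternal hWc hWdiv hWmild hWN, fun s t hst x => ?_, hWN, hpt, fun t x => ?_⟩
  · rw [heatFlow_of_pos _ (sub_pos.2 hst)]
    exact hWmild s t hst x
  · rw [hWG t x]; exact hptG t x

end Compactness

/-! ### Registered tools stub -/

/-- **Registered tools stub of the line `Sketch` (crux `TypeIliouvilleNoTypeII`,
stmt-NavierStokesRegularity-0056)**: the `C¹_loc` compactness of bounded Oseen-mild fields on growing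
two-sided windows, `exists_tendsto_of_bounded_seq`, in closed form. [cite: KochNadirashviliSereginSverak2009, Lemma 6.1 and Prop. 4.1 (arXiv:0709.3599 pp. 8, 11)] -/
theorem stub_activeWindowsExtractionTools :
    ∀ (N : ℝ) (A B : ℕ → ℝ), Tendsto A atTop atBot → Tendsto B atTop atTop →
      ∀ (w : ℕ → ℝ → EuclideanSpace ℝ (Fin 3) → EuclideanSpace ℝ (Fin 3)),
      (∀ k, ContinuousOn (uncurry (w k)) (Ioo (A k) (B k) ×ˢ univ)) →
      (∀ k, ∀ t ∈ Ioo (A k) (B k), IsWeaklyDivFree (w k t)) →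
      (∀ k, ∀ s t : ℝ, A k < s → s < t → t < B k → ∀ x,
        w k t x = UnboundedOperators.heatExtension (w k s) (t - s) x -
          oseenDuhamel 1 s (w k) (w k) t x) →
      (∀ k, ∀ t ∈ Ioo (A k) (B k), ∀ x, ‖w k t x‖ ≤ N) →
      ∃ φ : ℕ → ℕ, StrictMono φ ∧
        ∃ W : ℝ → EuclideanSpace ℝ (Fin 3) → EuclideanSpace ℝ (Fin 3),
          ContDiff ℝ (⊤ : ℕ∞) (uncurry W) ∧ (∀ t, VectorCalculus.IsDivFree (W t)) ∧
          (∀ s t : ℝ, s < t → ∀ x, W t x = heatFlow (W s) (t - s) x - oseenDuhamel 1 s W W t x) ∧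
          (∀ t x, ‖W t x‖ ≤ N) ∧
          (∀ t x, Tendsto (fun j => w (φ j) t x) atTop (𝓝 (W t x))) ∧
          (∀ t x, Tendsto (fun j => fderiv ℝ (w (φ j) t) x) atTop (𝓝 (fderiv ℝ (W t) x))) :=
  fun N _ _ hA hB _ hc hdivw hmild hbd => exists_tendsto_of_bounded_seq N hA hB hc hdivw hmild hbd

end Summit.NavierStokesRegularity.NavierStokesRegularity.Theorems.TypeIliouvilleNoTypeII.ImmortalZoom

end
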